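import Literature.RepresentationTheory.KonnoKonno2007.RealUnitaryDualPair
import Literature.NumberTheory.Automorphic.UnitaryGroupArchimedeanPlaces
import Mathlib.Analysis.Matrix.PosDef
import HarnessLib

/-!
# The definite frame of the junction: `U(A)(ℂ) ≃ₜ* U(N,0)` for a positive definite hermitian `A` (Konno–Konno 2007 §3.1; Platonov–Rapinchuk §2.3)

Topic `RepresentationTheory/KonnoKonno2007`; namespace `Literature.RepresentationTheory.KonnoKonno2007.RealDualPair`.
Sibling of `RealUnitaryDualPairBallFrame` (the `ι₁` frame `U21 ≃ₜ* UForm (Fin 2) Unit`): at a DEFINITE archimedean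
place the real unitary group `U(A)(ℂ) = {g ∣ gᴴ A g = A}` of a positive definite hermitian matrix `A` is identified
with the first member `UForm n Empty = U(⋆, diag(1_n, −1_∅))` of the compact junction `Ginf n Empty R S` of
`RealUnitaryDualPair` — the frame in which `JunctionVacuumExponents` / `JunctionVacuumDefinite` read the vacuum
exponent of an archimedean Weil datum.

* §1 the Cholesky-type factor of a positive definite hermitian matrix from Mathlib's spectral theorem:
  `posDefFactor hA = diag(√λ) · U*` with **`conjTranspose_posDefFactor_mul_self : (posDefFactor hA)ᴴ * posDefFactor hA = A`**
  and `det_posDefFactor_ne_zero` (so `posDefFactorGL hA : GL n ℂ`);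
* §2 `signForm_submatrix_inl : (signForm n Empty).submatrix inl inl = 1`, and the frame
  **`definiteFrame hA : unitaryGroupOfForm ⋆ A ≃ₜ* UForm n Empty`**, `g ↦ reindex (T g T⁻¹)` (the tree's
  `unitaryGroupOfFormCongrOfEq` + `unitaryGroupOfFormReindex`), with **`det_coe_definiteFrame : det = det`**;
  the negative definite case **`definiteFrameNeg h : unitaryGroupOfForm ⋆ A ≃ₜ* UForm Empty n`** (`(-A).PosDef`;
  `U(A) = U(−A)`), `det_coe_definiteFrameNeg`;
* §3 at a complex place `w` of a number field `E` with `σ_w(J)` positive (resp. negative) definite: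
  **`archLocalDefiniteFrame : archLocal E N J w ≃ₜ* UForm (Fin N) Empty`** (resp. `…Neg : ≃ₜ* UForm Empty (Fin N)`) —
  `archLocal` IS `unitaryGroupOfForm ⋆ (J.map w.embedding)` — with `det` preserved.

Everything is constructed and proved (kernel); the only inputs are Mathlib's spectral theorem for hermitian matrices
(`Matrix.IsHermitian.spectral_theorem`, `Matrix.PosDef.eigenvalues_pos`) and the tree's form transports.  No record,
no cited hypothesis.  Use (Hodge-CM model-construction cell, ticket D-5/(c5), BINDER-TRIAGE §61–§62): the frame through
which the place-`b` factor of the pinned Weil representation at a definite place `b ≠ ι₁` becomes a datum over the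
compact junction (the symplectic-side transport is the cell's (J-plc), not here).

References: [KonnoKonno2007] §3.1 (the diagonal frame of `U(p,q)` and its maximal compact); [PlatonovRapinchuk1994]
§2.3 (isometric hermitian forms have conjugate unitary groups); G. H. Golub, C. F. Van Loan, *Matrix Computations*,
§4.2 (Cholesky / `A = Bᴴ B` for positive definite `A`) — conventions only.
-/

set_option autoImplicit false

noncomputable section

open scoped Matrix ComplexOrder ComplexConjugate
open Matrix

namespace Literature.RepresentationTheory.KonnoKonno2007

namespace RealDualPair

open Literature.NumberTheory.Automorphic Literature.NumberTheory.Automorphic.UnitaryGroup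

/-! ## 1. A factor `A = Tᴴ T` of a positive definite hermitian matrix -/

section Factor

variable {n : Type*} [Fintype n] [DecidableEq n] {A : Matrix n n ℂ}

/-- **`T = diag(√λ) · U*`** for `A = U diag(λ) U*` positive definite hermitian (Mathlib's eigenvector unitary and
eigenvalues). [folklore] -/
def posDefFactor (hA : A.PosDef) : Matrix n n ℂ :=
  diagonal (fun i => ((Real.sqrt (hA.1.eigenvalues i) : ℝ) : ℂ)) * star (hA.1.eigenvectorUnitary : Matrix n n ℂ)

/-- **`Tᴴ T = A`.** [folklore] -/
theorem conjTranspose_posDefFactor_mul_self (hA : A.PosDef) : (posDefFactor hA)ᴴ * posDefFactor hA = A := by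
  have hU : (star (hA.1.eigenvectorUnitary : Matrix n n ℂ))ᴴ = (hA.1.eigenvectorUnitary : Matrix n n ℂ) := by
    rw [← star_eq_conjTranspose, star_star]
  have hD : (diagonal fun i => ((Real.sqrt (hA.1.eigenvalues i) : ℝ) : ℂ))ᴴ =
      diagonal fun i => ((Real.sqrt (hA.1.eigenvalues i) : ℝ) : ℂ) := by
    rw [diagonal_conjTranspose]
    refine congrArg diagonal (funext fun i => ?_)
    exact Complex.conj_ofReal _
  have hsq : (diagonal fun i => ((Real.sqrt (hA.1.eigenvalues i) : ℝ) : ℂ)) *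
      (diagonal fun i => ((Real.sqrt (hA.1.eigenvalues i) : ℝ) : ℂ)) =
        diagonal (RCLike.ofReal ∘ hA.1.eigenvalues) := by
    rw [diagonal_mul_diagonal]
    refine congrArg diagonal (funext fun i => ?_)
    rw [Function.comp_apply, ← Complex.ofReal_mul, Real.mul_self_sqrt (le_of_lt (hA.eigenvalues_pos i))]
    rfl
  rw [posDefFactor, conjTranspose_mul, hU, hD, Matrix.mul_assoc, ← Matrix.mul_assoc (diagonal _) (diagonal _) _,
    hsq, ← Matrix.mul_assoc]
  conv_rhs => rw [hA.1.spectral_theorem, Unitary.conjStarAlgAut_apply]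

/-- `det T ≠ 0`. [folklore] -/
theorem det_posDefFactor_ne_zero (hA : A.PosDef) : (posDefFactor hA).det ≠ 0 := by
  rw [posDefFactor, det_mul, det_diagonal]
  refine mul_ne_zero (Finset.prod_ne_zero_iff.2 fun i _ => ?_) ?_
  · exact_mod_cast (Real.sqrt_pos.2 (hA.eigenvalues_pos i)).ne'
  · have h := Matrix.UnitaryGroup.det_isUnit (star hA.1.eigenvectorUnitary)
    exact h.ne_zero

/-- **The factor as an element of `GLₙ(ℂ)`.** [folklore] -/
def posDefFactorGL (hA : A.PosDef) : GL n ℂ :=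
  Matrix.GeneralLinearGroup.mkOfDetNeZero (posDefFactor hA) (det_posDefFactor_ne_zero hA)

/-- matrix of `posDefFactorGL hA`. [folklore] -/
@[simp] theorem coe_posDefFactorGL (hA : A.PosDef) :
    ((posDefFactorGL hA : GL n ℂ) : Matrix n n ℂ) = posDefFactor hA := rfl

/-- `formCongr ⋆ T 1 = Tᴴ T = A`. [folklore] -/
theorem formCongr_posDefFactorGL_one (hA : A.PosDef) :
    formCongr (starRingEnd ℂ) (posDefFactorGL hA) (1 : Matrix n n ℂ) = A := by
  rw [formCongr_star, coe_posDefFactorGL, Matrix.mul_one, conjTranspose_posDefFactor_mul_self]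

end Factor

/-! ## 2. The frames `U(A) ≃ₜ* UForm n Empty` (positive definite) and `U(A) ≃ₜ* UForm Empty n` (negative definite) -/

section Frame

variable {n : Type*} [Fintype n] [DecidableEq n] {A : Matrix n n ℂ}

omit [Fintype n] in
/-- `diag(1_n, −1_∅)` restricted to the `n`-block is the identity. [folklore] -/
theorem signForm_submatrix_inl :
    (signForm n Empty).submatrix (Sum.inl : n → n ⊕ Empty) Sum.inl = (1 : Matrix n n ℂ) := by
  ext i j
  exact Matrix.fromBlocks_apply₁₁ (1 : Matrix n n ℂ) 0 0 (-1 : Matrix Empty Empty ℂ) i j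

omit [Fintype n] in
/-- `diag(1_∅, −1_n)` restricted to the `n`-block is `−1`. [folklore] -/
theorem signForm_submatrix_inr :
    (signForm Empty n).submatrix (Sum.inr : n → Empty ⊕ n) Sum.inr = (-1 : Matrix n n ℂ) := by
  ext i j
  exact Matrix.fromBlocks_apply₂₂ (1 : Matrix Empty Empty ℂ) 0 0 (-1 : Matrix n n ℂ) i j

/-- the reindexing `n ≃ n ⊕ ∅`. [folklore] -/
def inlEquiv (n : Type*) : n ≃ n ⊕ Empty := (Equiv.sumEmpty n Empty).symm

/-- the reindexing `n ≃ ∅ ⊕ n`. [folklore] -/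
def inrEquiv (n : Type*) : n ≃ Empty ⊕ n := (Equiv.emptySum Empty n).symm

omit [Fintype n] [DecidableEq n] in
/-- unfolding. [folklore] -/
@[simp] theorem inlEquiv_apply (i : n) : inlEquiv n i = Sum.inl i := rfl

omit [Fintype n] [DecidableEq n] in
/-- unfolding. [folklore] -/
@[simp] theorem inrEquiv_apply (i : n) : inrEquiv n i = Sum.inr i := rfl

omit [Fintype n] in
/-- `(signForm n Empty).submatrix (inlEquiv n) (inlEquiv n) = 1`. [folklore] -/
theorem signForm_submatrix_inlEquiv :
    (signForm n Empty).submatrix (inlEquiv n) (inlEquiv n) = (1 : Matrix n n ℂ) :=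
  signForm_submatrix_inl

omit [Fintype n] in
/-- `(signForm Empty n).submatrix (inrEquiv n) (inrEquiv n) = -1`. [folklore] -/
theorem signForm_submatrix_inrEquiv :
    (signForm Empty n).submatrix (inrEquiv n) (inrEquiv n) = (-1 : Matrix n n ℂ) :=
  signForm_submatrix_inr

/-- `Tᴴ (diag(1, −1_∅)|_n) T = A`. [folklore] -/
theorem formCongr_posDefFactorGL_signForm (hA : A.PosDef) :
    formCongr (starRingEnd ℂ) (posDefFactorGL hA) ((signForm n Empty).submatrix (inlEquiv n) (inlEquiv n)) = A := by
  rw [signForm_submatrix_inlEquiv, formCongr_posDefFactorGL_one]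

/-- **THE POSITIVE DEFINITE FRAME `U(A)(ℂ) ≃ₜ* UForm n Empty = U(n, 0)`**, `g ↦ reindex (T g T⁻¹)`.
[cite: PlatonovRapinchuk1994, §2.3] [cite: KonnoKonno2007, §3.1] -/
def definiteFrame (hA : A.PosDef) : unitaryGroupOfForm (starRingEnd ℂ) A ≃ₜ* UForm n Empty :=
  (unitaryGroupOfFormCongrOfEq (starRingEnd ℂ) (posDefFactorGL hA)
      ((signForm n Empty).submatrix (inlEquiv n) (inlEquiv n)) A (formCongr_posDefFactorGL_signForm hA)).trans
    (unitaryGroupOfFormReindex (starRingEnd ℂ) (inlEquiv n) (signForm n Empty))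

/-- matrix of `definiteFrame hA g`: `reindex (T g T⁻¹)`. [folklore] -/
theorem coe_definiteFrame (hA : A.PosDef) (g : unitaryGroupOfForm (starRingEnd ℂ) A) :
    (((definiteFrame hA g : UForm n Empty) : GL (n ⊕ Empty) ℂ) : Matrix (n ⊕ Empty) (n ⊕ Empty) ℂ) =
      Matrix.reindex (inlEquiv n) (inlEquiv n)
        (((posDefFactorGL hA * (g : GL n ℂ) * (posDefFactorGL hA)⁻¹ : GL n ℂ)) : Matrix n n ℂ) :=
  rfl

/-- **`det (definiteFrame hA g) = det g`.** [folklore] -/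
theorem det_coe_definiteFrame (hA : A.PosDef) (g : unitaryGroupOfForm (starRingEnd ℂ) A) :
    (((definiteFrame hA g : UForm n Empty) : GL (n ⊕ Empty) ℂ) : Matrix (n ⊕ Empty) (n ⊕ Empty) ℂ).det =
      (((g : unitaryGroupOfForm (starRingEnd ℂ) A) : GL n ℂ) : Matrix n n ℂ).det := by
  rw [coe_definiteFrame, det_reindex_self, Units.val_mul, Units.val_mul, Matrix.coe_units_inv,
    det_conj (Units.isUnit _)]

/-- `U(A) = U(−A)` as subgroups of `GLₙ(ℂ)`. [folklore] -/
theorem unitaryGroupOfForm_neg (A : Matrix n n ℂ) :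
    unitaryGroupOfForm (starRingEnd ℂ) (-A) = unitaryGroupOfForm (starRingEnd ℂ) A := by
  ext g
  rw [mem_unitaryGroupOfForm_star_iff_conjTranspose, mem_unitaryGroupOfForm_star_iff_conjTranspose,
    Matrix.mul_neg, Matrix.neg_mul, neg_inj]

/-- `Tᴴ (diag(1_∅, −1)|_n) T = A` for `T` the factor of `−A`. [folklore] -/
theorem formCongr_posDefFactorGL_signForm_neg (h : (-A).PosDef) :
    formCongr (starRingEnd ℂ) (posDefFactorGL h) ((signForm Empty n).submatrix (inrEquiv n) (inrEquiv n)) = A := by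
  rw [signForm_submatrix_inrEquiv, formCongr_star, coe_posDefFactorGL, Matrix.mul_neg, Matrix.mul_one,
    Matrix.neg_mul, conjTranspose_posDefFactor_mul_self, neg_neg]

/-- **THE NEGATIVE DEFINITE FRAME `U(A)(ℂ) ≃ₜ* UForm Empty n = U(0, n)`** (`−A` positive definite).
[cite: PlatonovRapinchuk1994, §2.3] [cite: KonnoKonno2007, §3.1] -/
def definiteFrameNeg (h : (-A).PosDef) : unitaryGroupOfForm (starRingEnd ℂ) A ≃ₜ* UForm Empty n :=
  (unitaryGroupOfFormCongrOfEq (starRingEnd ℂ) (posDefFactorGL h)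
      ((signForm Empty n).submatrix (inrEquiv n) (inrEquiv n)) A (formCongr_posDefFactorGL_signForm_neg h)).trans
    (unitaryGroupOfFormReindex (starRingEnd ℂ) (inrEquiv n) (signForm Empty n))

/-- matrix of `definiteFrameNeg h g`: `reindex (T g T⁻¹)`. [folklore] -/
theorem coe_definiteFrameNeg (h : (-A).PosDef) (g : unitaryGroupOfForm (starRingEnd ℂ) A) :
    (((definiteFrameNeg h g : UForm Empty n) : GL (Empty ⊕ n) ℂ) : Matrix (Empty ⊕ n) (Empty ⊕ n) ℂ) =
      Matrix.reindex (inrEquiv n) (inrEquiv n)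
        (((posDefFactorGL h * (g : GL n ℂ) * (posDefFactorGL h)⁻¹ : GL n ℂ)) : Matrix n n ℂ) :=
  rfl

/-- **`det (definiteFrameNeg h g) = det g`.** [folklore] -/
theorem det_coe_definiteFrameNeg (h : (-A).PosDef) (g : unitaryGroupOfForm (starRingEnd ℂ) A) :
    (((definiteFrameNeg h g : UForm Empty n) : GL (Empty ⊕ n) ℂ) : Matrix (Empty ⊕ n) (Empty ⊕ n) ℂ).det =
      (((g : unitaryGroupOfForm (starRingEnd ℂ) A) : GL n ℂ) : Matrix n n ℂ).det := by
  rw [coe_definiteFrameNeg, det_reindex_self, Units.val_mul, Units.val_mul, Matrix.coe_units_inv,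
    det_conj (Units.isUnit _)]

end Frame

/-! ## 3. At a complex place: `archLocal E N J w ≃ₜ* UForm (Fin N) Empty` for `σ_w(J)` definite -/

section Place

variable (E : Type) [Field E] (N : ℕ) (J : Matrix (Fin N) (Fin N) E)
  (w : {w : NumberField.InfinitePlace E // w.IsComplex})

/-- **The definite frame at a complex place**: for `σ_w(J)` positive definite, `U(σ_w J)(ℂ) ≃ₜ* U(N, 0)` in the
junction's currency (`archLocal E N J w` IS `unitaryGroupOfForm ⋆ (J.map w.embedding)`). [cite: KonnoKonno2007, §3.1]
[cite: PlatonovRapinchuk1994, §2.3] -/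
def archLocalDefiniteFrame (hdef : (J.map w.1.embedding).PosDef) : archLocal E N J w ≃ₜ* UForm (Fin N) Empty :=
  definiteFrame hdef

/-- `det` through the definite frame at a place. [folklore] -/
theorem det_coe_archLocalDefiniteFrame (hdef : (J.map w.1.embedding).PosDef) (u : archLocal E N J w) :
    (((archLocalDefiniteFrame E N J w hdef u : UForm (Fin N) Empty) : GL (Fin N ⊕ Empty) ℂ) :
        Matrix (Fin N ⊕ Empty) (Fin N ⊕ Empty) ℂ).det =
      (((u : archLocal E N J w) : GL (Fin N) ℂ) : Matrix (Fin N) (Fin N) ℂ).det :=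
  det_coe_definiteFrame hdef u

/-- **The negative definite frame at a complex place**: for `−σ_w(J)` positive definite,
`U(σ_w J)(ℂ) ≃ₜ* U(0, N)`. [cite: KonnoKonno2007, §3.1] [cite: PlatonovRapinchuk1994, §2.3] -/
def archLocalDefiniteFrameNeg (hdef : (-J.map w.1.embedding).PosDef) : archLocal E N J w ≃ₜ* UForm Empty (Fin N) :=
  definiteFrameNeg hdef

/-- `det` through the negative definite frame at a place. [folklore] -/
theorem det_coe_archLocalDefiniteFrameNeg (hdef : (-J.map w.1.embedding).PosDef) (u : archLocal E N J w) :
    (((archLocalDefiniteFrameNeg E N J w hdef u : UForm Empty (Fin N)) : GL (Empty ⊕ Fin N) ℂ) :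
        Matrix (Empty ⊕ Fin N) (Empty ⊕ Fin N) ℂ).det =
      (((u : archLocal E N J w) : GL (Fin N) ℂ) : Matrix (Fin N) (Fin N) ℂ).det :=
  det_coe_definiteFrameNeg hdef u

/-- Either sign: at a place where `σ_w(J)` is definite, `U(σ_w J)(ℂ)` is compact (the tree's
`isCompact_archLocal_of_posDef`, restated for the consumer of the frames). [cite: PlatonovRapinchuk1994, §3.2 Thm 3.1] -/
theorem compactSpace_archLocal_of_definite
    (hdef : (J.map w.1.embedding).PosDef ∨ (-J.map w.1.embedding).PosDef) : CompactSpace (archLocal E N J w) :=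
  isCompact_iff_compactSpace.mp (isCompact_archLocal_of_posDef E N J w hdef)

end Place

end RealDualPair

end Literature.RepresentationTheory.KonnoKonno2007
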